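import Mathlib.GroupTheory.GroupAction.Quotient
import Mathlib.SetTheory.Cardinal.Finite
import Literature.AnabelianGeometry.SemiGraphs.OrbitGraphOrbits
import Literature.AnabelianGeometry.SemiGraphs.OrbitGraphFinite
import Literature.AnabelianGeometry.SemiGraphs.TemperedVerticial
import Literature.AnabelianGeometry.SemiGraphs.MorphismsOver
import HarnessLib

/-!
# The cyclomatic number of the graph of a covering dominating elevation approximators
# ([SemiAnbd] Def. 2.4 (i) p. 25, Prop. 3.6 p. 38)

Mochizuki, *Semi-graphs of anabelioids*, Publ. RIMS **42** (2006) [SemiAnbd]: Def. 2.4 (i) p. 25 (`v` is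
*elevated*: for every `M` some `π₁`-epimorphic approximator `G → G'` carries `N_M ⊆ π̂₁(G'_v)` of order
`≥ M` meeting every conjugate of every `π̂₁(G'_e)`, `e` abutting to `v`, trivially) and Prop. 3.6 p. 38
(the Galois tower `{𝒢_i}`, `π₁^temp(𝒢) := lim Gal(𝒢_{∞,i}/𝒢)`, `𝒢_{∞,i}` "determined by the universal
graph-covering of the underlying semi-graph `𝔾_i`"). [cite: MochizukiSemiAnbd2006, Prop 3.6 p.38]

PROOF-ONLY file (abc-iut cell, prover abc-iut-w5-d240; no definitions): the COUNT turning total elevation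
into non-abelianness of the graph fundamental groups `π₁(𝔾_i)` of the Galois levels (consumer:
`TemperedPiTowerNonabelianLevel.lean`, discharging `hnonab` of `ProfiniteSemiGraph.temperedPi_tower`).
* `card_mul_card_orbitQuotient_le` — orbit-refinement count for group actions: `P` acting on a finite
  `X`, `π : P ↠ F` finite with every stabiliser in `Ker π`, `B ≤ P`, `N ≤ F` with `N ∩ π(B) = 1` ⇒
  `|N| · #(X/P) ≤ #(X/B)`;
* `CovObj.card_oVertex_over_eq` / `card_oEdge_over_eq` / `card_orbitQuotient_edge_eq_branch` — the fibres
  of `𝔾_S` (`OrbitGraph.lean`) over `v` / `e` are the orbit spaces of `S_v` / `S_e`, and along `b : e → v`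
  the `Π_e`-orbits of `S_e ≅ b^* S_v` are the `Π_b`-orbits of `S_v`;
* `CovObj.card_mul_card_oVertex_le_card_oEdge` — `S` DOMINATING at `v` an approximator with elevation
  subgroup `N` has `|N| · #(vertex-orbits over v) ≤ #(edge-orbits over e)` for `e` abutting to `v`;
* `CovObj.card_oEdge_add_card_closed_le` — `#edge-orbits + #closed-edge-orbits ≤ #abutting branch-orbits`;
* `CovObj.cyclomatic_count` — `𝔾` finite connected, every vertex on a CLOSED edge, `S` finite dominating
  such approximators with `|N| > #vertices` everywhere ⇒ `#V(𝔾_S) + #E(𝔾_S) + 1 ≤ #abutting branches`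
  (cyclomatic number `≥ 2`; input of `SemiGraph.exists_not_commute_fundamentalGroup`).

Elementary counting over the cell's §3 presentation; no statement of the paper is strengthened; nothing
here bears on [IUTchIII] Cor. 3.12 or takes a side on any disputed claim.
-/
noncomputable section

namespace Literature.AnabelianGeometry.SemiGraphs

open CategoryTheory MulAction

universe u

/-! ### 1. The orbit-refinement count (group actions) -/

section OrbitCount

variable {P : Type*} [Group P] {X : Type*} [MulAction P X] {F : Type*} [Group F]

/-- **Orbit refinement count.**  `P` acts on a finite `X`, `π : P ↠ F` finite with every stabiliser in
`ker π`, `B ≤ P`, `N ≤ F` meets `π(B)` trivially ⇒ every `P`-orbit splits into `≥ |N|` orbits of `B`: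
`|N| · #(X/P) ≤ #(X/B)` (the count behind Def. 2.4 (i)). [cite: MochizukiSemiAnbd2006, Def 2.4(i) p.25] -/
theorem card_mul_card_orbitQuotient_le [Finite X] [Finite F] (π : P →* F)
    (hπ : Function.Surjective π) (hdom : ∀ (p : P) (x : X), p • x = x → π p = 1)
    (B : Subgroup P) (N : Subgroup F) (hN : N ⊓ B.map π = ⊥) :
    Nat.card N * Nat.card (orbitRel.Quotient P X) ≤ Nat.card (orbitRel.Quotient B X) := by
  classical
  set B' : Subgroup F := B.map π
  -- (1) `N` embeds into the right cosets `π(B) \ F` = the `B'`-orbits of `F`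
  have h1 : Nat.card N ≤ Nat.card (orbitRel.Quotient B' F) := by
    refine Nat.card_le_card_of_injective
      (fun n : N => (Quotient.mk (orbitRel B' F) (n : F) : orbitRel.Quotient B' F)) ?_
    intro n₁ n₂ h
    obtain ⟨⟨b, hb⟩, hbn⟩ := Quotient.exact h
    have hbn' : b * (n₂ : F) = n₁ := hbn
    have hmem : (n₁ : F) * (n₂ : F)⁻¹ ∈ N ⊓ B' := by
      refine ⟨N.mul_mem n₁.2 (N.inv_mem n₂.2), ?_⟩
      rw [← hbn', mul_inv_cancel_right]
      exact hb
    rw [hN, Subgroup.mem_bot, mul_inv_eq_one] at hmem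
    exact Subtype.ext hmem
  -- (2) a `B`-invariant surjection `X → (X/P) × (B' \ F)`
  let q : X → orbitRel.Quotient P X := fun x => Quotient.mk (orbitRel P X) x
  have hsel : ∀ x : X, ∃ p : P, p • (q x).out = x := fun x => by
    obtain ⟨p, hp⟩ : (q x).out ∈ orbit P x := Quotient.exact (Quotient.out_eq (q x))
    exact ⟨p⁻¹, by rw [← hp, inv_smul_smul]⟩
  let f : X → F := fun x => π (hsel x).choose
  have hK : ∀ (x : X) (p : P), p • (q x).out = x → π p = f x := by
    intro x p hp
    have h1 : ((hsel x).choose⁻¹ * p) • (q x).out = (q x).out := by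
      rw [mul_smul, hp, inv_smul_eq_iff, (hsel x).choose_spec]
    have h2 := hdom _ _ h1
    rw [map_mul, map_inv, inv_mul_eq_one] at h2
    exact h2.symm
  let Ψ : X → orbitRel.Quotient P X × orbitRel.Quotient B' F := fun x =>
    (q x, Quotient.mk (orbitRel B' F) (f x))
  have hresp : ∀ x y : X, orbitRel B X x y → Ψ x = Ψ y := by
    intro x y hxy
    obtain ⟨b, hb⟩ := hxy
    have hb' : ((b : P) • y : X) = x := hb
    have hq : q x = q y := Quotient.sound ⟨(b : P), hb'⟩
    have hfy := (hsel y).choose_spec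
    have hfx : π ((b : P) * (hsel y).choose) = f x := by
      refine hK x _ ?_
      rw [hq, mul_smul, hfy, hb']
    refine Prod.ext hq (Quotient.sound ?_)
    refine ⟨⟨π b, Subgroup.mem_map_of_mem π b.2⟩, ?_⟩
    change π b * f y = f x
    rw [← hfx, map_mul]
  have hsurj : Function.Surjective Ψ := by
    rintro ⟨Q, R⟩
    obtain ⟨φ, rfl⟩ := Quotient.exists_rep R
    obtain ⟨p, rfl⟩ := hπ φ
    refine ⟨p • Q.out, ?_⟩
    have hq : q (p • Q.out) = Q := by
      have : q (p • Q.out) = q Q.out := Quotient.sound ⟨p, rfl⟩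
      rw [this]
      exact Quotient.out_eq Q
    refine Prod.ext hq ?_
    change Quotient.mk (orbitRel B' F) (f (p • Q.out)) = Quotient.mk (orbitRel B' F) (π p)
    rw [← hK (p • Q.out) p (by rw [hq])]
  -- (3) count
  let Ψ' : orbitRel.Quotient B X → orbitRel.Quotient P X × orbitRel.Quotient B' F :=
    Quotient.lift Ψ hresp
  have hsurj' : Function.Surjective Ψ' := fun t => by
    obtain ⟨x, hx⟩ := hsurj t
    exact ⟨Quotient.mk _ x, hx⟩
  haveI : Finite (orbitRel.Quotient B X) := Quotient.finite _
  have h3 := Nat.card_le_card_of_surjective Ψ' hsurj'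
  rw [Nat.card_prod] at h3
  calc Nat.card N * Nat.card (orbitRel.Quotient P X)
      ≤ Nat.card (orbitRel.Quotient B' F) * Nat.card (orbitRel.Quotient P X) :=
        Nat.mul_le_mul_right _ h1
    _ = Nat.card (orbitRel.Quotient P X) * Nat.card (orbitRel.Quotient B' F) := mul_comm _ _
    _ ≤ Nat.card (orbitRel.Quotient B X) := h3

end OrbitCount

namespace ProfiniteSemiGraph

variable {𝒢 : ProfiniteSemiGraph.{u}} (S : CovObj 𝒢)

/-! ### 2. Orbit quotients of the constituents and the fibres of the orbit graph -/

/-- `glue⁻¹ (glue y) = y` (as in `UniversalCoveringOver.lean`). [cite: MochizukiSemiAnbd2006, Def 3.5(i) p.37] -/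
private theorem CovObj.glue_inv_hom' (b : 𝒢.graph.Branch) (v : 𝒢.graph.Vertex)
    (h : 𝒢.graph.abuts b = some v) (y : (S.SE (𝒢.graph.edgeOf b)).obj.V) :
    (S.glue b v h).inv.hom.hom ((S.glue b v h).hom.hom.hom y) = y :=
  ConcreteCategory.congr_hom (congrArg
    (fun φ : S.SE (𝒢.graph.edgeOf b) ⟶ S.SE (𝒢.graph.edgeOf b) => φ.hom.hom)
    (S.glue b v h).hom_inv_id) y

/-- `glue (glue⁻¹ x) = x`. [cite: MochizukiSemiAnbd2006, Def 3.5(i) p.37] -/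
private theorem CovObj.glue_hom_inv' (b : 𝒢.graph.Branch) (v : 𝒢.graph.Vertex)
    (h : 𝒢.graph.abuts b = some v) (x : (S.SV v).obj.V) :
    (S.glue b v h).hom.hom.hom ((S.glue b v h).inv.hom.hom x) = x :=
  ConcreteCategory.congr_hom (congrArg
    (fun φ : (BTemp.res (𝒢.brHom b v h)).obj (S.SV v) ⟶ (BTemp.res (𝒢.brHom b v h)).obj (S.SV v) =>
      φ.hom.hom) (S.glue b v h).inv_hom_id) x

/-- The vertex-orbits of `𝔾_S` over `v` are the `Π_v`-orbits of `S_v`.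
[cite: MochizukiSemiAnbd2006, Def 3.5(i) p.37] -/
theorem CovObj.card_oVertex_over_eq (v : 𝒢.graph.Vertex) [Finite (S.SV v).obj.V] :
    letI := Action.instMulAction (S.SV v).obj
    Nat.card {V : S.OVertex // CovObj.OVertex.base S V = v} =
      Nat.card (orbitRel.Quotient (𝒢.Gv v) (S.SV v).obj.V) := by
  letI := Action.instMulAction (S.SV v).obj
  symm
  refine Nat.card_congr (Equiv.ofBijective
    (Quotient.lift (fun x : (S.SV v).obj.V =>
      (⟨Quot.mk S.VRel ⟨v, x⟩, rfl⟩ : {V : S.OVertex // CovObj.OVertex.base S V = v}))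
      (fun x y hxy => ?_)) ⟨?_, ?_⟩)
  · obtain ⟨g, hg⟩ := hxy
    refine Subtype.ext ?_
    change (Quot.mk S.VRel ⟨v, x⟩ : S.OVertex) = Quot.mk S.VRel ⟨v, y⟩
    rw [← hg]
    exact (Quot.sound (CovObj.VRel.mk v g y)).symm
  · intro a b hab
    induction a using Quotient.inductionOn with | h x => ?_
    induction b using Quotient.inductionOn with | h y => ?_
    have h := congrArg Subtype.val hab
    obtain ⟨g, hg⟩ := S.exists_ρ_of_mk_eq_mk h
    refine Quotient.sound ⟨g⁻¹, ?_⟩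
    change (S.SV v).obj.ρ g⁻¹ y = x
    rw [← hg]
    exact Action.ρ_inv_self_apply g x
  · rintro ⟨V, hV⟩
    subst hV
    obtain ⟨x, hx⟩ := CovObj.OVertex.exists_rep S V
    exact ⟨Quotient.mk _ x, Subtype.ext hx⟩

/-- The edge-orbits of `𝔾_S` over `e` are the `Π_e`-orbits of `S_e`.
[cite: MochizukiSemiAnbd2006, Def 3.5(i) p.37] -/
theorem CovObj.card_oEdge_over_eq (e : 𝒢.graph.Edge) [Finite (S.SE e).obj.V] :
    letI := Action.instMulAction (S.SE e).obj
    Nat.card {E : S.OEdge // CovObj.OEdge.base S E = e} =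
      Nat.card (orbitRel.Quotient (𝒢.Ge e) (S.SE e).obj.V) := by
  letI := Action.instMulAction (S.SE e).obj
  symm
  refine Nat.card_congr (Equiv.ofBijective
    (Quotient.lift (fun y : (S.SE e).obj.V =>
      (⟨Quot.mk S.ERel ⟨e, y⟩, rfl⟩ : {E : S.OEdge // CovObj.OEdge.base S E = e}))
      (fun x y hxy => ?_)) ⟨?_, ?_⟩)
  · obtain ⟨g, hg⟩ := hxy
    refine Subtype.ext ?_
    change (Quot.mk S.ERel ⟨e, x⟩ : S.OEdge) = Quot.mk S.ERel ⟨e, y⟩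
    rw [← hg]
    exact (Quot.sound (CovObj.ERel.mk e g y)).symm
  · intro a b hab
    induction a using Quotient.inductionOn with | h x => ?_
    induction b using Quotient.inductionOn with | h y => ?_
    have h := congrArg Subtype.val hab
    obtain ⟨g, hg⟩ := S.exists_ρE_of_mk_eq_mk h
    refine Quotient.sound ⟨g⁻¹, ?_⟩
    change (S.SE e).obj.ρ g⁻¹ y = x
    rw [← hg]
    exact Action.ρ_inv_self_apply g x
  · rintro ⟨E, hE⟩
    subst hE
    obtain ⟨y, hy⟩ := CovObj.OEdge.exists_rep S E
    exact ⟨Quotient.mk _ y, Subtype.ext hy⟩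

/-- Along a branch `b : e → v`, the `Π_e`-orbits of `S_e` are the orbits of the branch subgroup
`Π_b = b_*(Π_e) ≤ Π_v` on `S_v` (through the gluing `S_e ≅ b^* S_v`).
[cite: MochizukiSemiAnbd2006, Def 3.5(i) p.37] -/
theorem CovObj.card_orbitQuotient_edge_eq_branch (b : 𝒢.graph.Branch) (v : 𝒢.graph.Vertex)
    (h : 𝒢.graph.abuts b = some v) :
    letI := Action.instMulAction (S.SE (𝒢.graph.edgeOf b)).obj
    letI := Action.instMulAction (S.SV v).obj
    Nat.card (orbitRel.Quotient (𝒢.Ge (𝒢.graph.edgeOf b)) (S.SE (𝒢.graph.edgeOf b)).obj.V) =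
      Nat.card (orbitRel.Quotient (𝒢.branchSubgroup b v h) (S.SV v).obj.V) := by
  letI := Action.instMulAction (S.SE (𝒢.graph.edgeOf b)).obj
  letI := Action.instMulAction (S.SV v).obj
  let ε : (S.SE (𝒢.graph.edgeOf b)).obj.V ≃ (S.SV v).obj.V :=
    { toFun := fun y => (S.glue b v h).hom.hom.hom y
      invFun := fun x => (S.glue b v h).inv.hom.hom x
      left_inv := fun y => S.glue_inv_hom' b v h y
      right_inv := fun x => S.glue_hom_inv' b v h x }
  refine Nat.card_congr (Quotient.congr ε fun y y' => ?_)
  change y ∈ orbit _ y' ↔ ε y ∈ orbit _ (ε y')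
  constructor
  · rintro ⟨g, hg⟩
    refine ⟨⟨𝒢.brHom b v h g, g, rfl⟩, ?_⟩
    change (S.SV v).obj.ρ (𝒢.brHom b v h g) ((S.glue b v h).hom.hom.hom y') =
      (S.glue b v h).hom.hom.hom y
    rw [← S.glue_ρ b v h g y']
    exact congrArg _ hg
  · rintro ⟨⟨β, g, hg⟩, hβ⟩
    refine ⟨g, ?_⟩
    apply ε.injective
    have hg' : 𝒢.brHom b v h g = β := hg
    have hβ' : (S.SV v).obj.ρ β (ε y') = ε y := hβ
    change ε ((S.SE (𝒢.graph.edgeOf b)).obj.ρ g y') = ε y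
    rw [← hβ', ← hg']
    exact S.glue_ρ b v h g y'


/-! ### 3. The cyclomatic count of a finite covering dominating elevation approximators -/

/-- The other branch of a closed edge abuts to a vertex too: a closed edge `e` and a branch `b` of `e`
admit a branch `b' ≠ b` of `e` abutting to some vertex. [cite: MochizukiSemiAnbd2006, §1 p.12] -/
private theorem exists_ne_abuts_of_isClosedEdge {G : SemiGraph.{u}} {e : G.Edge}
    (he : G.IsClosedEdge e) (b : G.Branch) :
    ∃ b' : G.Branch, G.edgeOf b' = e ∧ b' ≠ b ∧ (G.abuts b').isSome := by
  unfold SemiGraph.IsClosedEdge SemiGraph.vertCard at he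
  obtain ⟨x, y, hxy, -⟩ := Nat.card_eq_two_iff.mp he
  by_cases hx : x.1 = b
  · refine ⟨y.1, y.2.1, fun h => hxy (Subtype.ext (hx.trans h.symm)), y.2.2⟩
  · exact ⟨x.1, x.2.1, hx, x.2.2⟩

/-- A branch of `𝔾_S` over an abutting branch of `𝔾` abuts.
[cite: MochizukiSemiAnbd2006, Def 3.5(i) p.37] -/
private theorem CovObj.orbitGraph_abuts_isSome (b : 𝒢.graph.Branch) (E : S.OEdge)
    (hE : CovObj.OEdge.base S E = 𝒢.graph.edgeOf b) (hb : (𝒢.graph.abuts b).isSome) :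
    (S.orbitGraph.abuts ⟨(b, E), hE⟩).isSome := by
  obtain ⟨w, hw⟩ := Option.isSome_iff_exists.mp hb
  rw [S.orbitGraph_abuts_of_abuts b E hE w hw]
  exact S.glueOpt_isSome b w hw E hE

/-- **Edge-orbits plus closed-edge-orbits inject into the abutting branches of `𝔾_S`** (`𝔾` connected
with a vertex: an edge-orbit gives the branch over a chosen abutting branch of its edge and, when that
edge is closed, a second one over the other branch). [cite: MochizukiSemiAnbd2006, Def 3.5(i) p.37] -/
theorem CovObj.card_oEdge_add_card_closed_le (hconn : 𝒢.graph.IsConnected) (v₀ : 𝒢.graph.Vertex)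
    [Finite S.OEdge] [Finite S.orbitGraph.Branch] :
    Nat.card S.OEdge +
        Nat.card {E : S.OEdge // 𝒢.graph.IsClosedEdge (CovObj.OEdge.base S E)} ≤
      Nat.card {β : S.orbitGraph.Branch // (S.orbitGraph.abuts β).isSome} := by
  classical
  -- a chosen abutting branch of every edge, and the other branch of a closed edge
  have hab := fun e => SemiGraph.exists_abuts_of_isConnected hconn v₀ e
  let β₁ : 𝒢.graph.Edge → 𝒢.graph.Branch := fun e => (hab e).choose
  have hβ₁ : ∀ e, 𝒢.graph.edgeOf (β₁ e) = e ∧ (𝒢.graph.abuts (β₁ e)).isSome := fun e =>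
    (hab e).choose_spec
  have hoth := fun (E : {E : S.OEdge // 𝒢.graph.IsClosedEdge (CovObj.OEdge.base S E)}) =>
    exists_ne_abuts_of_isClosedEdge E.2 (β₁ (CovObj.OEdge.base S E.1))
  let β₂ : {E : S.OEdge // 𝒢.graph.IsClosedEdge (CovObj.OEdge.base S E)} → 𝒢.graph.Branch :=
    fun E => (hoth E).choose
  have hβ₂ : ∀ E, 𝒢.graph.edgeOf (β₂ E) = CovObj.OEdge.base S E.1 ∧
      β₂ E ≠ β₁ (CovObj.OEdge.base S E.1) ∧ (𝒢.graph.abuts (β₂ E)).isSome := fun E =>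
    (hoth E).choose_spec
  let ι : S.OEdge ⊕ {E : S.OEdge // 𝒢.graph.IsClosedEdge (CovObj.OEdge.base S E)} →
      {β : S.orbitGraph.Branch // (S.orbitGraph.abuts β).isSome} := fun s =>
    match s with
    | Sum.inl E => ⟨⟨(β₁ (CovObj.OEdge.base S E), E), (hβ₁ _).1.symm⟩,
        S.orbitGraph_abuts_isSome _ E _ (hβ₁ _).2⟩
    | Sum.inr E => ⟨⟨(β₂ E, E.1), (hβ₂ E).1.symm⟩, S.orbitGraph_abuts_isSome _ E.1 _ (hβ₂ E).2.2⟩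
  have hι : Function.Injective ι := by
    intro s t hst
    have hp := congrArg (fun z : {β : S.orbitGraph.Branch // (S.orbitGraph.abuts β).isSome} =>
      z.1.1) hst
    rcases s with E₁ | E₁ <;> rcases t with E₂ | E₂ <;> obtain ⟨hb, hE⟩ := Prod.mk.inj hp
    · exact congrArg Sum.inl hE
    · exact absurd (hE ▸ hb).symm (hβ₂ E₂).2.1
    · exact absurd (hE ▸ hb) (hβ₂ E₁).2.1
    · exact congrArg Sum.inr (Subtype.ext hE)
  rw [← Nat.card_sum]
  exact Nat.card_le_card_of_injective ι hι

/-- **The orbit-refinement count at a vertex** of a covering `S` DOMINATING an approximator `A` at `v`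
(every stabiliser in `S_v` lies in `Ker(Π_v ↠ Π'_v)`) with `N ≤ Π'_v` meeting every conjugate of every
branch image trivially (Def. 2.4 (i)): along an abutting branch `b : e → v`,
`|N| · #(vertex-orbits over v) ≤ #(edge-orbits over e)`. [cite: MochizukiSemiAnbd2006, Def 2.4(i) p.25] -/
theorem CovObj.card_mul_card_oVertex_le_card_oEdge (A : 𝒢.Approximator) (v : 𝒢.graph.Vertex)
    (hπ : Function.Surjective (A.πV v)) (N : Subgroup (A.FV v))
    (hN : ∀ (b : 𝒢.graph.Branch) (h : 𝒢.graph.abuts b = some v) (g : A.FV v),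
      N ⊓ ((A.brF b v h).range.map (MulAut.conj g).toMonoidHom) = ⊥)
    (hdom : ∀ (x : (S.SV v).obj.V) (p : 𝒢.Gv v), (S.SV v).obj.ρ p x = x → A.πV v p = 1)
    (b : 𝒢.graph.Branch) (h : 𝒢.graph.abuts b = some v)
    [Finite (S.SV v).obj.V] [Finite (S.SE (𝒢.graph.edgeOf b)).obj.V] :
    Nat.card N * Nat.card {V : S.OVertex // CovObj.OVertex.base S V = v} ≤
      Nat.card {E : S.OEdge // CovObj.OEdge.base S E = 𝒢.graph.edgeOf b} := by
  letI := Action.instMulAction (S.SV v).obj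
  letI := Action.instMulAction (S.SE (𝒢.graph.edgeOf b)).obj
  rw [S.card_oVertex_over_eq v, S.card_oEdge_over_eq, S.card_orbitQuotient_edge_eq_branch b v h]
  refine card_mul_card_orbitQuotient_le (A.πV v) hπ (fun p x hx => hdom x p hx)
    (𝒢.branchSubgroup b v h) N ?_
  -- `π_v(Π_b) ≤ γ_{g₀⁻¹}(b'_*(Π'_e))` by the 2-cell of the approximator at `b`
  obtain ⟨g₀, hg₀⟩ := A.comm b v h
  have hle : (𝒢.branchSubgroup b v h).map (A.πV v) ≤
      (A.brF b v h).range.map (MulAut.conj g₀⁻¹).toMonoidHom := by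
    rintro _ ⟨p, ⟨x, rfl⟩, rfl⟩
    refine ⟨A.brF b v h (A.πE _ x), ⟨A.πE _ x, rfl⟩, ?_⟩
    change g₀⁻¹ * A.brF b v h (A.πE _ x) * g₀⁻¹⁻¹ = A.πV v ((𝒢.brHom b v h).toMonoidHom x)
    rw [hg₀ x, inv_inv]
    change _ = A.πV v (𝒢.brHom b v h x)
    simp only [mul_assoc, inv_mul_cancel, mul_one, inv_mul_cancel_left]
  exact le_bot_iff.mp ((inf_le_inf_left N hle).trans (hN b h g₀⁻¹).le)

/-- **The cyclomatic count.**  `𝒢` with finitely many vertices and edges, connected, every vertex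
abutting to a CLOSED edge; `S` a finite covering with a nonempty vertex fibre which at every vertex `v`
dominates an approximator (`Π_v ↠ Π'_v`) carrying a subgroup of order `> #vertices` meeting the
conjugates of the branch images trivially (Def. 2.4 (i)).  Then `𝔾_S` has cyclomatic number `≥ 2`:
`#vertex-orbits + #edge-orbits + 1 ≤ #abutting branch-orbits`. [cite: MochizukiSemiAnbd2006, Prop 3.6 p.38] -/
theorem CovObj.cyclomatic_count [Finite 𝒢.graph.Vertex] [Finite 𝒢.graph.Edge] (hS : S.IsFinite)
    (hconn : 𝒢.graph.IsConnected) (v₀ : 𝒢.graph.Vertex) (x₀ : (S.SV v₀).obj.V)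
    (hve : ∀ v : 𝒢.graph.Vertex, ∃ b : 𝒢.graph.Branch,
      𝒢.graph.abuts b = some v ∧ 𝒢.graph.IsClosedEdge (𝒢.graph.edgeOf b))
    (hdom : ∀ v : 𝒢.graph.Vertex, ∃ A : 𝒢.Approximator, Function.Surjective (A.πV v) ∧
      (∃ N : Subgroup (A.FV v), Nat.card 𝒢.graph.Vertex + 1 ≤ Nat.card N ∧
        ∀ (b : 𝒢.graph.Branch) (h : 𝒢.graph.abuts b = some v) (g : A.FV v),
          N ⊓ ((A.brF b v h).range.map (MulAut.conj g).toMonoidHom) = ⊥) ∧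
      ∀ (x : (S.SV v).obj.V) (p : 𝒢.Gv v), (S.SV v).obj.ρ p x = x → A.πV v p = 1) :
    Nat.card S.orbitGraph.Vertex + Nat.card S.orbitGraph.Edge + 1 ≤
      Nat.card {β : S.orbitGraph.Branch // (S.orbitGraph.abuts β).isSome} := by
  classical
  haveI : ∀ v, Finite (S.SV v).obj.V := hS.finite_V
  haveI : ∀ e, Finite (S.SE e).obj.V := hS.finite_E
  haveI : Finite S.OVertex := S.finite_oVertex hS
  haveI : Finite S.OEdge := S.finite_oEdge hS
  haveI : Finite S.orbitGraph.Branch := S.finite_orbitGraph_branch hS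
  letI : Fintype 𝒢.graph.Vertex := Fintype.ofFinite _
  change Nat.card S.OVertex + Nat.card S.OEdge + 1 ≤ _
  set c := Nat.card {E : S.OEdge // 𝒢.graph.IsClosedEdge (CovObj.OEdge.base S E)}
  -- per-vertex count: `(#V(𝔾) + 1) · n_v ≤ c`
  have hv : ∀ v : 𝒢.graph.Vertex, (Nat.card 𝒢.graph.Vertex + 1) *
      Nat.card {V : S.OVertex // CovObj.OVertex.base S V = v} ≤ c := by
    intro v
    obtain ⟨b, hb, hcl⟩ := hve v
    obtain ⟨A, hπ, ⟨N, hN, hNel⟩, hdomv⟩ := hdom v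
    calc (Nat.card 𝒢.graph.Vertex + 1) * Nat.card {V : S.OVertex // CovObj.OVertex.base S V = v}
        ≤ Nat.card N * Nat.card {V : S.OVertex // CovObj.OVertex.base S V = v} :=
          Nat.mul_le_mul_right _ hN
      _ ≤ Nat.card {E : S.OEdge // CovObj.OEdge.base S E = 𝒢.graph.edgeOf b} :=
          S.card_mul_card_oVertex_le_card_oEdge A v hπ N hNel hdomv b hb
      _ ≤ c := Nat.card_le_card_of_injective
          (fun E => (⟨E.1, E.2.symm ▸ hcl⟩ :
            {E : S.OEdge // 𝒢.graph.IsClosedEdge (CovObj.OEdge.base S E)}))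
          (fun E₁ E₂ hE => Subtype.ext (by simpa using congrArg Subtype.val hE))
  -- summing over the vertices: `(#V(𝔾) + 1) · #V(𝔾_S) ≤ #V(𝔾) · c`
  have hsum : Nat.card S.OVertex =
      ∑ v : 𝒢.graph.Vertex, Nat.card {V : S.OVertex // CovObj.OVertex.base S V = v} := by
    rw [← Nat.card_sigma]
    exact Nat.card_congr (Equiv.sigmaFiberEquiv (CovObj.OVertex.base S)).symm
  have hV : (Nat.card 𝒢.graph.Vertex + 1) * Nat.card S.OVertex ≤ Nat.card 𝒢.graph.Vertex * c := by
    rw [hsum, Finset.mul_sum]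
    refine (Finset.sum_le_sum fun v _ => hv v).trans ?_
    rw [Finset.sum_const, smul_eq_mul, Finset.card_univ, ← Nat.card_eq_fintype_card]
  -- `#V(𝔾_S) ≥ 1`, hence `#V(𝔾_S) + 1 ≤ c`; with the edge count this is the claim
  have hpos : 0 < Nat.card S.OVertex := Nat.card_pos_iff.mpr ⟨⟨Quot.mk _ ⟨v₀, x₀⟩⟩, inferInstance⟩
  have hE := S.card_oEdge_add_card_closed_le hconn v₀
  nlinarith

end ProfiniteSemiGraph

end Literature.AnabelianGeometry.SemiGraphs

end
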